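import Literature.Computability.Complexity.AverageCaseDepthHierarchyTypical
import HarnessLib

/-!
# Typical restrictions of the RST process and the probability of losing typicality (§10.1)

B. Rossman, R. A. Servedio, L.-Y. Tan, *An average-case depth hierarchy theorem for Boolean
circuits*, arXiv:1504.03398 [RossmanServedioTan2015], §10.1 Definition 14 (p. 31, typical
`τ`), Proposition 10 (p. 32, `ρ̂` is typical w.h.p. for `ρ ← R_init`), Proposition 11 (p. 32–34,
typical yields typical), and §10.2 eq. (27)–(28) (p. 35–36, the last stage).

For a process `P : ProcParams` (blocks of stage `j+1` = children `(g,i)` of the depth-`j` gates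
`g : Blk P.W j`) this file defines the typicality predicates fed to `ProcParams.V_ge`:

* `TypMid P E j' τ` (stages strictly between top and bottom; RST Def. 14 with (1) weakened to what
  is used — every block is falsified or in case 2 — and (2) as printed: every depth-`j'` gate has
  at most `E` determined children);
* `TypFin P lo hi τ` (the restriction of the root block met at the end: no child of the root is
  already controlling, and the number of starred children is in `[lo, hi]` — RST (27), (28));
* `Typ P E lo hi jtop j` (`= allStar` at the top stage `jtop`, `TypMid` in between, `TypFin` at `0`),
  with its decidability;

and proves the **propagation bounds** `weight_not_TypMid_le`, `weight_not_TypFin_le` (from a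
`TypMid` stage or from the all-star top stage) — the failure weight is at most
`#gates · (e^{-Δ₊²/(4 W qhi)} + e^{-Δ₋²/(4 K qlo)}) + #grandparents · e^{2 W'' (W λ + (1-qlo)^K) - (E+1)}`
(`+ W₀ λ` at the last stage) — by the three estimates of `AverageCaseDepthHierarchyTypical` and
union bounds. All numerical side conditions are explicit hypotheses; RST's parameters are
substituted in the sibling asymptotics file.
-/

noncomputable section

namespace Literature.Computability.Complexity

namespace RSTProj

open Finset

namespace ProcParams

variable (P : ProcParams)

/-- **Typical, middle stages** (RST Def. 14 for `τ ∈ {•,∘,⋆}^{A_{j'+2}}`, i.e. a restriction of the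
level-`(j'+2)` variables whose blocks are the depth-`(j'+1)` gates): (1) every block is already
falsified or in case 2 (no bullet, acceptable number of stars), and (2) every depth-`j'` gate has
at most `E` children whose value is already determined. [cite: RossmanServedioTan2015, §10.1 Def. 14 (p. 31)] -/
def TypMid (E : ℕ) (j' : ℕ) (τ : Blk P.W j' × Fin (P.W j') → Fin (P.W (j' + 1)) → Option Bool) : Prop :=
  (∀ a : Blk P.W (j' + 1), (∃ i, τ a i = some (!(P.law (j' + 1)).o)) ∨ (P.law (j' + 1)).Case2 (τ a)) ∧
  (∀ α : Blk P.W j', ((univ : Finset (Fin (P.W j'))).filter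
    fun i => liftBlock (P.law (j' + 1)).o (τ (α, i)) ≠ none).card ≤ E)

/-- **Typical, last stage** (what RST (27)–(28) establish about `ρ̂^{(2)}`): no child of the root is
already controlling (`ρ̂ ∈ {0,⋆}^{w₀}`), and the number of starred children is in the window. [cite: RossmanServedioTan2015, §10.2 eq. (27)–(28) (p. 35–36)] -/
def TypFin (lo hi : ℝ) (τ : BRestr (Blk P.W 0) (Fin (P.W 0))) : Prop :=
  (∀ i, τ default i ≠ some (!(P.law 0).o)) ∧ lo ≤ ((stars (τ default)).card : ℝ) ∧ ((stars (τ default)).card : ℝ) ≤ hi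

/-- **The typicality predicates of the process** run from the all-star restriction at the top stage
`jtop`: all-star at `jtop`, `TypMid` strictly in between, `TypFin` at the end. [cite: RossmanServedioTan2015, §10.1 Def. 14 (p. 31) and Props. 10–11 (p. 32)] -/
def Typ (E : ℕ) (lo hi : ℝ) (jtop : ℕ) : (j : ℕ) → BRestr (Blk P.W j) (Fin (P.W j)) → Prop
  | 0, τ => P.TypFin lo hi τ
  | j' + 1, τ => if j' + 1 = jtop then τ = P.allStar (j' + 1) else P.TypMid E j' τ

/-- Decidability of `TypMid`. [folklore] -/
instance (E j' : ℕ) (τ : Blk P.W j' × Fin (P.W j') → Fin (P.W (j' + 1)) → Option Bool) : Decidable (P.TypMid E j' τ) :=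
  inferInstanceAs (Decidable (_ ∧ _))

/-- Decidability of `TypFin`. [folklore] -/
instance (lo hi : ℝ) (τ : BRestr (Blk P.W 0) (Fin (P.W 0))) : Decidable (P.TypFin lo hi τ) :=
  Classical.dec _

/-- Decidability of `Typ`. [folklore] -/
instance instDecidablePredTyp (E : ℕ) (lo hi : ℝ) (jtop j : ℕ) : DecidablePred (P.Typ E lo hi jtop j) :=
  fun _ => Classical.dec _

/-! ### The failure events of one stage, bounded by the three estimates -/

section Stage

variable {P} {j : ℕ} {qlo qhi : ℝ}

/-- Sums of a nonnegative weight over a union. [folklore] -/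
theorem weight_union_le {Ω : Type*} [DecidableEq Ω] (μ : Ω → ℝ) (hμ : ∀ x, 0 ≤ μ x) (s t : Finset Ω) :
    ∑ x ∈ s ∪ t, μ x ≤ ∑ x ∈ s, μ x + ∑ x ∈ t, μ x := by
  classical
  rw [← Finset.sum_union_inter]
  have : 0 ≤ ∑ x ∈ s ∩ t, μ x := Finset.sum_nonneg fun x _ => hμ x
  linarith

/-- **Star counts of all gates stay in the window** (RST Lemma 14 / Lemma 10 with the union bound
over the gates): if every depth-`j` gate has its children in order and at least `K` of them in case
2, then the weight of the restrictions under which SOME gate `g` has `starCount g ρ ≤ lo` or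
`≥ hi` is at most `|Blk W j| (e^{-Δ₊²/(4 W_j qhi)} + e^{-Δ₋²/(4 K qlo)})`, where
`hi = W_j qhi + Δ₊`, `lo = K qlo - Δ₋`. [cite: RossmanServedioTan2015, §10.1 Lemmas 10, 14 and Props. 10–11 (pp. 32–33)] -/
theorem weight_exists_starCount_bad_le (h : (P.law (j + 1)).LawBounds qlo qhi)
    {τ : Blk P.W j × Fin (P.W j) → Fin (P.W (j + 1)) → Option Bool}
    (hok : ∀ g : Blk P.W j, (P.law (j + 1)).ChildOK τ g) {K : ℝ} (hK : ∀ g : Blk P.W j, K ≤ ((P.law (j + 1)).undet τ g).card)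
    (hMhi : 0 < (P.W j : ℝ) * qhi) (hMlo : 0 < K * qlo) {Δp Δm : ℝ} (hΔp0 : 0 ≤ Δp) (hΔp : Δp ≤ 2 * (P.W j * qhi))
    (hΔm0 : 0 ≤ Δm) (hΔm : Δm ≤ 2 * (K * qlo)) :
    ∑ ρ ∈ univ.filter (fun ρ : Blk P.W j × Fin (P.W j) → Fin (P.W (j + 1)) → Option Bool => ∃ g : Blk P.W j,
        (((P.law (j + 1)).starCount g ρ : ℕ) : ℝ) ≤ K * qlo - Δm ∨ P.W j * qhi + Δp ≤ ((P.law (j + 1)).starCount g ρ : ℕ)),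
      (P.law (j + 1)).R τ ρ ≤
      Fintype.card (Blk P.W j) * (Real.exp (-(Δp ^ 2 / (4 * (P.W j * qhi)))) + Real.exp (-(Δm ^ 2 / (4 * (K * qlo))))) := by
  classical
  set L := P.law (j + 1) with hL
  have hR0 : ∀ ρ, 0 ≤ L.R τ ρ := fun ρ => Finset.prod_nonneg fun a _ => h.ζ_nonneg _ _
  have key := weight_exists_le (L.R τ) hR0 (univ : Finset (Blk P.W j)) (fun g ρ =>
    ((L.starCount g ρ : ℕ) : ℝ) ≤ K * qlo - Δm ∨ P.W j * qhi + Δp ≤ ((L.starCount g ρ : ℕ) : ℝ))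
  have e : univ.filter (fun ρ : Blk P.W j × Fin (P.W j) → Fin (P.W (j + 1)) → Option Bool => ∃ g : Blk P.W j,
      ((L.starCount g ρ : ℕ) : ℝ) ≤ K * qlo - Δm ∨ P.W j * qhi + Δp ≤ ((L.starCount g ρ : ℕ) : ℝ)) =
      univ.filter (fun ρ => ∃ g ∈ (univ : Finset (Blk P.W j)),
        ((L.starCount g ρ : ℕ) : ℝ) ≤ K * qlo - Δm ∨ P.W j * qhi + Δp ≤ ((L.starCount g ρ : ℕ) : ℝ)) :=
    Finset.filter_congr fun ρ _ => by simp only [Finset.mem_univ, true_and]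
  rw [e]
  refine key.trans ?_
  have hg : ∀ g : Blk P.W j, ∑ ρ ∈ univ.filter (fun ρ => ((L.starCount g ρ : ℕ) : ℝ) ≤ K * qlo - Δm ∨
      P.W j * qhi + Δp ≤ ((L.starCount g ρ : ℕ) : ℝ)), L.R τ ρ ≤
      Real.exp (-(Δp ^ 2 / (4 * (P.W j * qhi)))) + Real.exp (-(Δm ^ 2 / (4 * (K * qlo)))) := by
    intro g
    have hup := L.weight_starCount_ge_le h (hok g) hMhi hΔp0 hΔp
    have hlo := L.weight_starCount_le_le h (hok g) (hK g) hMlo hΔm0 hΔm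
    have hsub : univ.filter (fun ρ => ((L.starCount g ρ : ℕ) : ℝ) ≤ K * qlo - Δm ∨ P.W j * qhi + Δp ≤ ((L.starCount g ρ : ℕ) : ℝ)) ⊆
        univ.filter (fun ρ : Blk P.W j × Fin (P.W j) → Fin (P.W (j + 1)) → Option Bool => P.W j * qhi + Δp ≤ ((L.starCount g ρ : ℕ) : ℝ)) ∪
          univ.filter (fun ρ : Blk P.W j × Fin (P.W j) → Fin (P.W (j + 1)) → Option Bool => ((L.starCount g ρ : ℕ) : ℝ) ≤ K * qlo - Δm) := by
      intro ρ hρ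
      rw [Finset.mem_filter] at hρ
      rw [Finset.mem_union, Finset.mem_filter, Finset.mem_filter]
      rcases hρ.2 with h1 | h1
      · exact Or.inr ⟨hρ.1, h1⟩
      · exact Or.inl ⟨hρ.1, h1⟩
    calc _ ≤ _ := Finset.sum_le_sum_of_subset_of_nonneg hsub fun ρ _ _ => hR0 ρ
      _ ≤ _ := weight_union_le _ hR0 _ _
      _ ≤ _ := add_le_add hup hlo
  calc ∑ g : Blk P.W j, ∑ ρ ∈ univ.filter (fun ρ => ((L.starCount g ρ : ℕ) : ℝ) ≤ K * qlo - Δm ∨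
        P.W j * qhi + Δp ≤ ((L.starCount g ρ : ℕ) : ℝ)), L.R τ ρ
      ≤ ∑ _g : Blk P.W j, (Real.exp (-(Δp ^ 2 / (4 * (P.W j * qhi)))) + Real.exp (-(Δm ^ 2 / (4 * (K * qlo))))) :=
        Finset.sum_le_sum fun g _ => hg g
    _ = _ := by rw [Finset.sum_const, Finset.card_univ, nsmul_eq_mul]

/-- The parents of the children of the grandparent `α`. [folklore] -/
def siblings (P : ProcParams) {j' : ℕ} (α : Blk P.W j') : Finset (Blk P.W (j' + 1)) :=
  (univ : Finset (Fin (P.W j'))).map ⟨fun i => (α, i), fun _ _ h => (Prod.ext_iff.1 h).2⟩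

/-- There are `W_{j'}` siblings. [folklore] -/
theorem card_siblings (P : ProcParams) {j' : ℕ} (α : Blk P.W j') : (P.siblings α).card = P.W j' := by
  simp [siblings]

/-- **Few determined gates below every grandparent** (RST Lemmas 12, 16 with the union bound): the
weight of the restrictions under which some depth-`j'` gate `α` has more than `E` determined
children is at most `|Blk W j'| e^{2 W_{j'} (W_{j'+1} λ + (1-qlo)^K) - (E+1)}`. [cite: RossmanServedioTan2015, §10.1 Lemmas 12, 16 (pp. 32, 34)] -/
theorem weight_exists_detCount_bad_le {j' : ℕ} (h : (P.law (j' + 1 + 1)).LawBounds qlo qhi) (hq1 : qlo ≤ 1)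
    {τ : Blk P.W (j' + 1) × Fin (P.W (j' + 1)) → Fin (P.W (j' + 1 + 1)) → Option Bool}
    (hok : ∀ g : Blk P.W (j' + 1), (P.law (j' + 1 + 1)).ChildOK τ g) {K : ℕ}
    (hK : ∀ g : Blk P.W (j' + 1), K ≤ ((P.law (j' + 1 + 1)).undet τ g).card) (E : ℕ) :
    ∑ ρ ∈ univ.filter (fun ρ : Blk P.W (j' + 1) × Fin (P.W (j' + 1)) → Fin (P.W (j' + 1 + 1)) → Option Bool => ∃ α : Blk P.W j',
        ((E : ℝ) + 1) ≤ ((P.law (j' + 1 + 1)).detCount (P.siblings α) ρ : ℕ)), (P.law (j' + 1 + 1)).R τ ρ ≤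
      Fintype.card (Blk P.W j') *
        Real.exp (2 * (P.W j' * (P.W (j' + 1) * (P.law (j' + 1 + 1)).lam + (1 - qlo) ^ K)) - (E + 1)) := by
  classical
  set L := P.law (j' + 1 + 1) with hL
  have hR0 : ∀ ρ, 0 ≤ L.R τ ρ := fun ρ => Finset.prod_nonneg fun a _ => h.ζ_nonneg _ _
  have key := weight_exists_le (L.R τ) hR0 (univ : Finset (Blk P.W j')) (fun α ρ =>
    ((E : ℝ) + 1) ≤ ((L.detCount (P.siblings α) ρ : ℕ) : ℝ))
  have e : univ.filter (fun ρ : Blk P.W (j' + 1) × Fin (P.W (j' + 1)) → Fin (P.W (j' + 1 + 1)) → Option Bool => ∃ α : Blk P.W j',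
      ((E : ℝ) + 1) ≤ ((L.detCount (P.siblings α) ρ : ℕ) : ℝ)) =
      univ.filter (fun ρ => ∃ α ∈ (univ : Finset (Blk P.W j')), ((E : ℝ) + 1) ≤ ((L.detCount (P.siblings α) ρ : ℕ) : ℝ)) :=
    Finset.filter_congr fun ρ _ => by simp only [Finset.mem_univ, true_and]
  rw [e]
  refine key.trans ?_
  have hα : ∀ α : Blk P.W j', ∑ ρ ∈ univ.filter (fun ρ => ((E : ℝ) + 1) ≤ ((L.detCount (P.siblings α) ρ : ℕ) : ℝ)), L.R τ ρ ≤
      Real.exp (2 * (P.W j' * (P.W (j' + 1) * L.lam + (1 - qlo) ^ K)) - (E + 1)) := by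
    intro α
    have := L.weight_detCount_ge_le h hq1 (P.siblings α) (fun g _ => hok g) (fun g _ => hK g) ((E : ℝ) + 1)
    rwa [card_siblings] at this
  calc ∑ α : Blk P.W j', ∑ ρ ∈ univ.filter (fun ρ => ((E : ℝ) + 1) ≤ ((L.detCount (P.siblings α) ρ : ℕ) : ℝ)), L.R τ ρ
      ≤ ∑ _α : Blk P.W j', Real.exp (2 * (P.W j' * (P.W (j' + 1) * L.lam + (1 - qlo) ^ K)) - (E + 1)) :=
        Finset.sum_le_sum fun α _ => hα α
    _ = _ := by rw [Finset.sum_const, Finset.card_univ, nsmul_eq_mul]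

end Stage

/-! ### Typicality of the lift: the failure events are among the bounded ones -/

section Lift

variable {P} {qlo qhi : ℝ}

/-- Under a typical restriction (or the all-star one) every gate has its children in order and at
least `W - E` of them in case 2 — the inputs of the three estimates. [cite: RossmanServedioTan2015, §10.1 Def. 14 (p. 31, (26) and the remark after it)] -/
theorem childOK_of_TypMid {E j : ℕ} {τ : Blk P.W j × Fin (P.W j) → Fin (P.W (j + 1)) → Option Bool} (hτ : P.TypMid E j τ)
    (g : Blk P.W j) : (P.law (j + 1)).ChildOK τ g ∧ P.W j - E ≤ ((P.law (j + 1)).undet τ g).card := by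
  classical
  refine ⟨fun i => hτ.1 (g, i), ?_⟩
  have hsub : univ.filter (fun i : Fin (P.W j) => liftBlock (P.law (j + 1)).o (τ (g, i)) = none) ⊆ (P.law (j + 1)).undet τ g := by
    intro i hi
    rw [Finset.mem_filter] at hi
    show i ∈ univ.filter (fun i => (P.law (j + 1)).Case2 (τ (g, i)))
    rw [Finset.mem_filter]
    refine ⟨hi.1, ?_⟩
    rcases hτ.1 (g, i) with ⟨k, hk⟩ | hc
    · exfalso
      have : liftBlock (P.law (j + 1)).o (τ (g, i)) = some (!(P.law (j + 1)).o) := by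
        unfold liftBlock; rw [if_pos ⟨k, hk⟩]
      rw [hi.2] at this; exact (Option.some_ne_none _) this.symm
    · exact hc
  have hcomp : (univ.filter (fun i : Fin (P.W j) => liftBlock (P.law (j + 1)).o (τ (g, i)) = none)).card +
      (univ.filter (fun i : Fin (P.W j) => liftBlock (P.law (j + 1)).o (τ (g, i)) ≠ none)).card = P.W j := by
    rw [Finset.card_filter_add_card_filter_not]; simp
  have h2 := hτ.2 g
  have := Finset.card_le_card hsub
  omega

/-- Under the all-star restriction every block is in case 2 as soon as the block length is
acceptable and nonzero (the top stage `R_init`). [cite: RossmanServedioTan2015, §7.2 Def. 6 (p. 16)] -/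
theorem childOK_allStar {j : ℕ} (hacc : (P.law (j + 1)).acc (P.W (j + 1)) = true) (hW : P.W (j + 1) ≠ 0)
    (g : Blk P.W j) : (P.law (j + 1)).ChildOK (P.allStar (j + 1)) g ∧ ((P.law (j + 1)).undet (P.allStar (j + 1)) g).card = P.W j := by
  classical
  have hstars : ∀ a : Blk P.W (j + 1), (stars (P.allStar (j + 1) a)).card = P.W (j + 1) := by
    intro a
    have : stars (P.allStar (j + 1) a) = univ := by ext i; simp [stars, allStar]
    rw [this, Finset.card_univ, Fintype.card_fin]
  have hc2 : ∀ a : Blk P.W (j + 1), (P.law (j + 1)).Case2 (P.allStar (j + 1) a) := fun a =>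
    ⟨fun i h => by simp [allStar] at h, by rw [hstars]; exact hacc, by rw [hstars]; exact hW⟩
  refine ⟨fun i => Or.inr (hc2 (g, i)), ?_⟩
  have : (P.law (j + 1)).undet (P.allStar (j + 1)) g = univ := by
    ext i; simp only [BlockLaw.undet, Finset.mem_filter, Finset.mem_univ, true_and, iff_true]; exact hc2 (g, i)
  rw [this, Finset.card_univ, Fintype.card_fin]

/-- **Losing `TypMid`** (RST Prop. 11 one level up, and Prop. 10 from the all-star top): if at stage
`j'+2` every depth-`(j'+1)` gate has its children in order with at least `K` in case 2, then the
lifted restriction fails to be `TypMid` at `j'` with weight at most the star-count bound plus the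
determined-count bound — provided the acceptability window of stage `j'+1` contains
`(K qlo - Δ₋, W qhi + Δ₊)` and `K qlo - Δ₋ ≥ 0`. [cite: RossmanServedioTan2015, §10.1 Props. 10, 11 (p. 32)] -/
theorem weight_not_TypMid_le {j' : ℕ} (hP : (P.law (j' + 1 + 1)).o = !(P.law (j' + 1)).o)
    (h : (P.law (j' + 1 + 1)).LawBounds qlo qhi) (hq1 : qlo ≤ 1)
    {τ : Blk P.W (j' + 1) × Fin (P.W (j' + 1)) → Fin (P.W (j' + 1 + 1)) → Option Bool}
    (hok : ∀ g : Blk P.W (j' + 1), (P.law (j' + 1 + 1)).ChildOK τ g) {K : ℕ}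
    (hK : ∀ g : Blk P.W (j' + 1), K ≤ ((P.law (j' + 1 + 1)).undet τ g).card)
    (hMhi : 0 < (P.W (j' + 1) : ℝ) * qhi) (hMlo : 0 < (K : ℝ) * qlo) {Δp Δm : ℝ} (hΔp0 : 0 ≤ Δp)
    (hΔp : Δp ≤ 2 * (P.W (j' + 1) * qhi)) (hΔm0 : 0 ≤ Δm) (hΔm : Δm ≤ 2 * (K * qlo)) (hlo0 : 0 ≤ K * qlo - Δm)
    (hacc : ∀ n : ℕ, K * qlo - Δm < n → (n : ℝ) < P.W (j' + 1) * qhi + Δp → (P.law (j' + 1)).acc n = true) (E : ℕ) :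
    ∑ ρ ∈ univ.filter (fun ρ : Blk P.W (j' + 1) × Fin (P.W (j' + 1)) → Fin (P.W (j' + 1 + 1)) → Option Bool =>
        ¬ P.TypMid E j' (liftR (P.law (j' + 1 + 1)).o ρ)), (P.law (j' + 1 + 1)).R τ ρ ≤
      Fintype.card (Blk P.W (j' + 1)) * (Real.exp (-(Δp ^ 2 / (4 * (P.W (j' + 1) * qhi)))) +
          Real.exp (-(Δm ^ 2 / (4 * (K * qlo))))) +
        Fintype.card (Blk P.W j') *
          Real.exp (2 * (P.W j' * (P.W (j' + 1) * (P.law (j' + 1 + 1)).lam + (1 - qlo) ^ K)) - (E + 1)) := by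
  classical
  set L := P.law (j' + 1 + 1) with hL
  have hR0 : ∀ ρ, 0 ≤ L.R τ ρ := fun ρ => Finset.prod_nonneg fun a _ => h.ζ_nonneg _ _
  -- the failure event is contained in the union of the two bounded events
  have hsub : univ.filter (fun ρ : Blk P.W (j' + 1) × Fin (P.W (j' + 1)) → Fin (P.W (j' + 1 + 1)) → Option Bool => ¬ P.TypMid E j' (liftR L.o ρ)) ⊆
      univ.filter (fun ρ => ∃ g : Blk P.W (j' + 1),
        (((L.starCount g ρ : ℕ) : ℝ) ≤ K * qlo - Δm ∨ P.W (j' + 1) * qhi + Δp ≤ ((L.starCount g ρ : ℕ) : ℝ))) ∪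
      univ.filter (fun ρ => ∃ α : Blk P.W j', ((E : ℝ) + 1) ≤ ((L.detCount (P.siblings α) ρ : ℕ) : ℝ)) := by
    intro ρ hρ
    rw [Finset.mem_filter] at hρ
    rw [Finset.mem_union, Finset.mem_filter, Finset.mem_filter]
    simp only [TypMid, not_and_or, not_forall] at hρ
    rcases hρ.2 with ⟨g, hg⟩ | ⟨α, hα⟩
    · left
      refine ⟨hρ.1, g, ?_⟩
      -- no bullet and not in case 2: the star count is out of the window (or zero)
      rw [not_or] at hg
      obtain ⟨hnb, hnc⟩ := hg
      have hnb' : ∀ i, liftBlock L.o (ρ (g, i)) ≠ some L.o := by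
        intro i hi; apply hnb; refine ⟨i, ?_⟩
        show liftBlock L.o (ρ (g, i)) = some (!(P.law (j' + 1)).o)
        rw [hi, hP]
      have hstars : (stars (liftR L.o ρ g)).card = L.starCount g ρ := by
        simp only [stars, BlockLaw.starCount, liftR]
      by_contra hwin
      push Not at hwin
      apply hnc
      refine ⟨fun i hi => hnb' i ?_, ?_, ?_⟩
      · rw [← hP] at hi; exact hi
      · rw [hstars]; exact hacc _ hwin.1 hwin.2
      · rw [hstars]
        intro h0
        rw [h0] at hwin
        simp only [CharP.cast_eq_zero] at hwin
        linarith [hwin.1]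
    · right
      refine ⟨hρ.1, α, ?_⟩
      push Not at hα
      have e : ((univ : Finset (Fin (P.W j'))).filter fun i => liftBlock (P.law (j' + 1)).o (liftR L.o ρ (α, i)) ≠ none).card =
          L.detCount (P.siblings α) ρ := by
        rw [BlockLaw.detCount, siblings, Finset.filter_map, Finset.card_map]
        congr 1
        ext i
        simp only [Finset.mem_filter, Finset.mem_univ, true_and, Function.comp_apply, Function.Embedding.coeFn_mk,
          BlockLaw.Det, hP, Bool.not_not]
        exact Iff.rfl
      have : (E : ℝ) + 1 ≤ ((L.detCount (P.siblings α) ρ : ℕ) : ℝ) := by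
        rw [← e]; exact_mod_cast hα
      exact this
  calc _ ≤ _ := Finset.sum_le_sum_of_subset_of_nonneg hsub fun ρ _ _ => hR0 ρ
    _ ≤ _ := weight_union_le _ hR0 _ _
    _ ≤ _ := add_le_add (weight_exists_starCount_bad_le h hok (fun g => by exact_mod_cast hK g) hMhi hMlo hΔp0 hΔp hΔm0 hΔm)
        (weight_exists_detCount_bad_le h hq1 hok hK E)

/-- **Losing `TypFin`** at the last stage (RST (27) and (28)): from a restriction under which the
root has its children in order with at least `K` in case 2, the lift fails `TypFin lo hi` with
weight at most `W₀ λ + e^{-Δ₊²/(4 W₀ qhi)} + e^{-Δ₋²/(4 K qlo)}` when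
`lo ≤ K qlo - Δ₋`, `W₀ qhi + Δ₊ ≤ hi`. [cite: RossmanServedioTan2015, §10.2 eq. (27)–(28) (p. 35–36)] -/
theorem weight_not_TypFin_le (hP : (P.law 1).o = !(P.law 0).o) (h : (P.law 1).LawBounds qlo qhi)
    {τ : Blk P.W 0 × Fin (P.W 0) → Fin (P.W 1) → Option Bool} (hok : (P.law 1).ChildOK τ default) {K : ℝ}
    (hK : K ≤ ((P.law 1).undet τ default).card) (hMhi : 0 < (P.W 0 : ℝ) * qhi) (hMlo : 0 < K * qlo)
    {Δp Δm : ℝ} (hΔp0 : 0 ≤ Δp) (hΔp : Δp ≤ 2 * (P.W 0 * qhi)) (hΔm0 : 0 ≤ Δm) (hΔm : Δm ≤ 2 * (K * qlo))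
    {lo hi : ℝ} (hlo : lo ≤ K * qlo - Δm) (hhi : P.W 0 * qhi + Δp ≤ hi) :
    ∑ ρ ∈ univ.filter (fun ρ : Blk P.W 0 × Fin (P.W 0) → Fin (P.W 1) → Option Bool => ¬ P.TypFin lo hi (liftR (P.law 1).o ρ)), (P.law 1).R τ ρ ≤
      P.W 0 * (P.law 1).lam + (Real.exp (-(Δp ^ 2 / (4 * (P.W 0 * qhi)))) + Real.exp (-(Δm ^ 2 / (4 * (K * qlo))))) := by
  classical
  set L := P.law 1 with hL
  have hR0 : ∀ ρ, 0 ≤ L.R τ ρ := fun ρ => Finset.prod_nonneg fun a _ => h.ζ_nonneg _ _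
  -- the three estimates, in the typing of this file
  have hc : ∑ ρ ∈ univ.filter (fun ρ : Blk P.W 0 × Fin (P.W 0) → Fin (P.W 1) → Option Bool =>
      ∃ i : Fin (P.W 0), liftBlock L.o (ρ (default, i)) = some L.o), L.R τ ρ ≤ P.W 0 * L.lam :=
    L.weight_exists_circ_le h hok
  have hup : ∑ ρ ∈ univ.filter (fun ρ : Blk P.W 0 × Fin (P.W 0) → Fin (P.W 1) → Option Bool =>
      P.W 0 * qhi + Δp ≤ ((L.starCount default ρ : ℕ) : ℝ)), L.R τ ρ ≤ Real.exp (-(Δp ^ 2 / (4 * (P.W 0 * qhi)))) :=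
    L.weight_starCount_ge_le h hok hMhi hΔp0 hΔp
  have hlo' : ∑ ρ ∈ univ.filter (fun ρ : Blk P.W 0 × Fin (P.W 0) → Fin (P.W 1) → Option Bool =>
      ((L.starCount default ρ : ℕ) : ℝ) ≤ K * qlo - Δm), L.R τ ρ ≤ Real.exp (-(Δm ^ 2 / (4 * (K * qlo)))) :=
    L.weight_starCount_le_le h hok hK hMlo hΔm0 hΔm
  have hsub : univ.filter (fun ρ : Blk P.W 0 × Fin (P.W 0) → Fin (P.W 1) → Option Bool => ¬ P.TypFin lo hi (liftR L.o ρ)) ⊆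
      univ.filter (fun ρ : Blk P.W 0 × Fin (P.W 0) → Fin (P.W 1) → Option Bool => ∃ i : Fin (P.W 0), liftBlock L.o (ρ (default, i)) = some L.o) ∪
      (univ.filter (fun ρ : Blk P.W 0 × Fin (P.W 0) → Fin (P.W 1) → Option Bool => P.W 0 * qhi + Δp ≤ ((L.starCount default ρ : ℕ) : ℝ)) ∪
        univ.filter (fun ρ : Blk P.W 0 × Fin (P.W 0) → Fin (P.W 1) → Option Bool => ((L.starCount default ρ : ℕ) : ℝ) ≤ K * qlo - Δm)) := by
    intro ρ hρ
    rw [Finset.mem_filter] at hρ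
    simp only [TypFin, not_and_or, not_forall, not_le] at hρ
    rw [Finset.mem_union, Finset.mem_union, Finset.mem_filter, Finset.mem_filter, Finset.mem_filter]
    have hstars : ((stars (liftR L.o ρ default)).card : ℝ) = ((L.starCount default ρ : ℕ) : ℝ) := by
      simp only [stars, BlockLaw.starCount, liftR]
    rcases hρ.2 with ⟨i, hi⟩ | hlt | hgt
    · left
      refine ⟨hρ.1, i, ?_⟩
      have : liftBlock L.o (ρ (default, i)) = some (!(P.law 0).o) := by
        push Not at hi; exact hi
      rw [this, hP]
    · right; right
      exact ⟨hρ.1, by rw [← hstars]; linarith⟩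
    · right; left
      exact ⟨hρ.1, by rw [← hstars]; linarith⟩
  calc _ ≤ _ := Finset.sum_le_sum_of_subset_of_nonneg hsub fun ρ _ _ => hR0 ρ
    _ ≤ _ := weight_union_le _ hR0 _ _
    _ ≤ P.W 0 * L.lam + (Real.exp (-(Δp ^ 2 / (4 * (P.W 0 * qhi)))) + Real.exp (-(Δm ^ 2 / (4 * (K * qlo))))) :=
        add_le_add hc ((weight_union_le _ hR0 _ _).trans (add_le_add hup hlo'))

end Lift

/-! ### Back to the typing of `ProcParams.V` (`ρ : BRestr (Blk W (j+1)) (Fin (W (j+1)))`) -/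

section Retype

variable {P}

/-- The level-`(j+1)` sums of this file (indexed by `Blk W j × Fin (W j) → _`) are the sums of
`ProcParams.V` (indexed by `BRestr (Blk W (j+1)) _`, the same type up to unfolding `Blk`); stated
through `Fintype.sum_equiv (Equiv.refl _)` so that no instance unfolding is needed downstream. [folklore] -/
theorem sum_filter_R_blk {j : ℕ} (L : BlockLaw) (τ : BRestr (Blk P.W (j + 1)) (Fin (P.W (j + 1))))
    (p : BRestr (Blk P.W (j + 1)) (Fin (P.W (j + 1))) → Prop) [DecidablePred p] :
    ∑ ρ ∈ univ.filter p, L.R τ ρ =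
      ∑ ρ ∈ (univ : Finset (Blk P.W j × Fin (P.W j) → Fin (P.W (j + 1)) → Option Bool)).filter (fun ρ => p ρ),
        L.R (A := Blk P.W j × Fin (P.W j)) τ ρ := by
  rw [Finset.sum_filter, Finset.sum_filter]
  refine Fintype.sum_equiv (Equiv.refl _) _ _ fun ρ => ?_
  rw [Equiv.refl_apply]
  have hR : L.R τ ρ = L.R (A := Blk P.W j × Fin (P.W j)) τ ρ :=
    Fintype.prod_equiv (Equiv.refl _) _ _ fun a => rfl
  rw [hR]

variable {qlo qhi : ℝ}

/-- `weight_not_TypMid_le` in the typing of `ProcParams.V`. [cite: RossmanServedioTan2015, §10.1 Props. 10, 11 (p. 32)] -/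
theorem weight_not_TypMid_le' {j' : ℕ} (hP : (P.law (j' + 1 + 1)).o = !(P.law (j' + 1)).o)
    (h : (P.law (j' + 1 + 1)).LawBounds qlo qhi) (hq1 : qlo ≤ 1)
    {τ : BRestr (Blk P.W (j' + 1 + 1)) (Fin (P.W (j' + 1 + 1)))}
    (hok : ∀ g : Blk P.W (j' + 1), (P.law (j' + 1 + 1)).ChildOK τ g) {K : ℕ}
    (hK : ∀ g : Blk P.W (j' + 1), K ≤ ((P.law (j' + 1 + 1)).undet τ g).card)
    (hMhi : 0 < (P.W (j' + 1) : ℝ) * qhi) (hMlo : 0 < (K : ℝ) * qlo) {Δp Δm : ℝ} (hΔp0 : 0 ≤ Δp)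
    (hΔp : Δp ≤ 2 * (P.W (j' + 1) * qhi)) (hΔm0 : 0 ≤ Δm) (hΔm : Δm ≤ 2 * (K * qlo)) (hlo0 : 0 ≤ K * qlo - Δm)
    (hacc : ∀ n : ℕ, K * qlo - Δm < n → (n : ℝ) < P.W (j' + 1) * qhi + Δp → (P.law (j' + 1)).acc n = true) (E : ℕ) :
    ∑ ρ ∈ univ.filter (fun ρ : BRestr (Blk P.W (j' + 1 + 1)) (Fin (P.W (j' + 1 + 1))) =>
        ¬ P.TypMid E j' (liftR (P.law (j' + 1 + 1)).o ρ)), (P.law (j' + 1 + 1)).R τ ρ ≤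
      Fintype.card (Blk P.W (j' + 1)) * (Real.exp (-(Δp ^ 2 / (4 * (P.W (j' + 1) * qhi)))) +
          Real.exp (-(Δm ^ 2 / (4 * (K * qlo))))) +
        Fintype.card (Blk P.W j') *
          Real.exp (2 * (P.W j' * (P.W (j' + 1) * (P.law (j' + 1 + 1)).lam + (1 - qlo) ^ K)) - (E + 1)) := by
  rw [sum_filter_R_blk]
  exact weight_not_TypMid_le hP h hq1 hok hK hMhi hMlo hΔp0 hΔp hΔm0 hΔm hlo0 hacc E

/-- `weight_not_TypFin_le` in the typing of `ProcParams.V`. [cite: RossmanServedioTan2015, §10.2 eq. (27)–(28) (p. 35–36)] -/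
theorem weight_not_TypFin_le' (hP : (P.law 1).o = !(P.law 0).o) (h : (P.law 1).LawBounds qlo qhi)
    {τ : BRestr (Blk P.W 1) (Fin (P.W 1))} (hok : (P.law 1).ChildOK τ default) {K : ℝ}
    (hK : K ≤ ((P.law 1).undet τ default).card) (hMhi : 0 < (P.W 0 : ℝ) * qhi) (hMlo : 0 < K * qlo)
    {Δp Δm : ℝ} (hΔp0 : 0 ≤ Δp) (hΔp : Δp ≤ 2 * (P.W 0 * qhi)) (hΔm0 : 0 ≤ Δm) (hΔm : Δm ≤ 2 * (K * qlo))
    {lo hi : ℝ} (hlo : lo ≤ K * qlo - Δm) (hhi : P.W 0 * qhi + Δp ≤ hi) :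
    ∑ ρ ∈ univ.filter (fun ρ : BRestr (Blk P.W 1) (Fin (P.W 1)) => ¬ P.TypFin lo hi (liftR (P.law 1).o ρ)), (P.law 1).R τ ρ ≤
      P.W 0 * (P.law 1).lam + (Real.exp (-(Δp ^ 2 / (4 * (P.W 0 * qhi)))) + Real.exp (-(Δm ^ 2 / (4 * (K * qlo))))) := by
  rw [sum_filter_R_blk]
  exact weight_not_TypFin_le hP h hok hK hMhi hMlo hΔp0 hΔp hΔm0 hΔm hlo hhi

end Retype

end ProcParams

end RSTProj

end Literature.Computability.Complexity

end
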